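import Literature.AlgebraicGeometry.HodgeTheory.UnitaryHodgeGroupPowersHodgeClasses
import Literature.AlgebraicGeometry.Motives.HodgeThetaSubalgebraUnitaryFourTwo
import HarnessLib

/-!
# The unitary socket discharged on Ribet type `(4,2)`: `Lie Hg = 𝔲_k` for an abelian sixfold with `End⁰ = k` imaginary quadratic acting with multiplicities `(4,2)`, and the Hodge conjecture for all its powers — UNCONDITIONAL (Moonen–Zarhin 1999 (2.3)–(2.5), Table 1 row IV`(4,2)`; Ribet 1983 Thm. 0)

Family `hodge`, layer `Literature/AlgebraicGeometry/HodgeTheory`; cell `pub-hodgeav-hg6` (row 2 «base of HC ladder», TABLE X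
row 8-`(4,2)`, brick H1; nothing here proves HC, HC_AV or HC_CM). UNCONDITIONAL; theorems only, no definition, no named
fact, no `sorry`; nothing of G1 (`UnitaryHodgeGroupPowersHodgeClasses`), R9 (`RibetTypeOnePowersHodgeClasses`) or L13 is
restated.  This is the `(4,2)` twin of the `(m,1)` adapter `UnitaryHodgeGroupOfRibetTypeOne`: the Lie theorem
`UnitaryThetaFourTwo.mem_hodgeLieC_of_commute_of_skew` (`Motives/HodgeThetaSubalgebraUnitaryFourTwo`, brick H1a: the
`(2,4)` complex core V5 + the socket U1d/U1c/U1b + the radical kill U1) read through the multiplicity dictionary of R9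
(`finrank_eigenspace_inf_piece_oneZero_eq_eigenMultiplicity`, `…_zeroOne_eq_eigenMultiplicity_conj`,
`exists_eq_smul_one_add_smul_bettiMapHom`, `bettiMapHom_mul_self`) IS the hypothesis `hU` of G1 / L13:
* §1 **`hodgeLieC_fourTwo_of_eigenMultiplicity`** — for `φ ≫ φ = -d` (`d > 0`), `finrank_ℚ End⁰(A) = 2`, eigen-multiplicities
  `{4, 2}` at `± i√d` and ANY polarization `ψ` of `H¹(A(ℂ); ℚ)`: every `(φ^*)_ℂ`-commuting `ψ_ℂ`-skew operator lies in
  `Lie Hg(H¹(A)) ⊗ ℂ` (Moonen–Zarhin (2.3) «`Hg(X) = U_k(V,ψ)`», `(n′,n″) = (4,2)`, in Lie form);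
* §2 fed to G1 BY NAME (`AVSlots.isDivisorGenerated_of_hodgeLieC_unitary` and its corollaries), with the polarization and the
  Betti-universe facts supplied as in R9 (`smoothProjective_hodgeStructure_isPolarizable_holds`,
  `exists_isReal_hodgeModel_holds`, `hodgePQ_independent_of_hodgeModel_holds`): **`AVSlots.isDivisorGenerated_of_fourTwo`**
  (`B•(B) = D•(B) ⊗ ℂ` for every `B` with slots over `A`), **`AbelianVariety.isDivisorGenerated_powSucc_of_fourTwo`**,
  `…_of_fourTwo`, **`hodgeConjectureFor_powSucc_of_fourTwo`**, **`hodgeConjectureFor_of_isIsogenous_powSucc_of_fourTwo`** —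
  the Hodge conjecture for every complex abelian variety isogenous to a power of such a sixfold, UNCONDITIONAL (MZ99 Table 1,
  row IV `(4,2)`: «Hodge ring generated by divisor classes» for the general member; here for ALL members with `End⁰ = k`,
  the case MZ99 attribute to Tankeev — `Hg = U_k` is forced arithmetically).

## References

* [MoonenZarhin1999LowDim] B. Moonen, Yu. Zarhin, Math. Ann. 315 (1999) = arXiv:math/9901113, §1 (1.8), §2 (2.3)–(2.5),
  Table 1 row IV `(4,2)`.
* [Ribet1983] K. A. Ribet, Amer. J. Math. 105 (1983), Thm. 0 and Thm. 3.
* [Deligne1982HodgeCycles] P. Deligne, LNM 900 (1982), I §3 Prop. 3.4, Prop. 3.6.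
* [Gordon1997] B. B. Gordon, arXiv:alg-geom/9709030, Thm. 6.3 (3), §6 pp. 18–19.
* [vanGeemen1994HodgeAV] B. van Geemen, *An introduction to the Hodge conjecture for abelian varieties*, §2.4, Lemma 3.7.
-/

noncomputable section

open scoped TensorProduct
open CategoryTheory Module

namespace Literature.AlgebraicGeometry.HodgeTheory

open Literature.AlgebraicTopology.SingularHomology
open Literature.AlgebraicGeometry.Motives (IsSmoothProjective AbelianVariety bettiCohomology
  ofRatClassBaseChange ofRatClassBaseChange_tmul HodgeTensorFacts hodgeTensorFacts_holds)
open Literature.Barriers.HodgeConjecture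
open Literature.AlgebraicGeometry.Motives.HodgeStructure
open Literature.AlgebraicGeometry.ComplexMultiplication (bettiRep_of)

variable {A : AbelianVariety ℂ}

/-! ## §1 `hU` for Ribet type `(4,2)` -/

/-- **`hU` for an abelian variety of Ribet type `(4,2)`** (`φ ≫ φ = -d`, `d > 0`, `finrank_ℚ End⁰(A) = 2`, eigen-multiplicities
`{4,2}` at `i√d`, `-i√d` — so `dim A = 6` —, ANY polarization `ψ` of `H¹(A(ℂ); ℚ)`): every `(φ^*)_ℂ`-commuting `ψ_ℂ`-skew
operator lies in `Lie Hg(H¹(A)) ⊗ ℂ`, i.e. `Hg(A) = U_k(H¹(A;ℚ), ψ)` in Lie form (brick H1a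
`UnitaryThetaFourTwo.mem_hodgeLieC_of_commute_of_skew` at `μ = i√d`, through the multiplicity dictionary of R9).
[cite: MoonenZarhin1999LowDim, §2 (2.3)–(2.5) and Table 1] [cite: Ribet1983, Thm. 3] [cite: Deligne1982HodgeCycles, I §3 Prop. 3.4 and 3.6] -/
theorem hodgeLieC_fourTwo_of_eigenMultiplicity [HodgeTensorFacts.{0, 0}] (φ : A ⟶ A) {d : ℕ} (hd : 0 < d)
    (hφ : φ ≫ φ = -(d • 𝟙 A)) (hE2 : Module.finrank ℚ A.endAlgebra = 2)
    (h42 : (eigenMultiplicity A φ (Complex.I * (Real.sqrt d : ℂ)) = 4 ∧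
        eigenMultiplicity A φ (-(Complex.I * (Real.sqrt d : ℂ))) = 2) ∨
      (eigenMultiplicity A φ (Complex.I * (Real.sqrt d : ℂ)) = 2 ∧
        eigenMultiplicity A φ (-(Complex.I * (Real.sqrt d : ℂ))) = 4))
    (hHD : exists_isReal_hodgeModel) (hI : hodgePQ_independent_of_hodgeModel)
    (ψ : (BettiUniverse.hodge hHD (AbelianVariety.isSmoothProjective_holds (A := A)) 1).Polarization) :
    ∀ Y : Module.End ℂ (ℂ ⊗[ℚ] bettiCohomology A.X 1),
      Y * ((bettiCohomology.map φ.hom.hom.hom 1).hom).baseChange ℂ =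
          ((bettiCohomology.map φ.hom.hom.hom 1).hom).baseChange ℂ * Y →
        (∀ x y, ψ.form.baseChange ℂ (Y x) y + ψ.form.baseChange ℂ x (Y y) = 0) →
          Y ∈ (BettiUniverse.hodge hHD (AbelianVariety.isSmoothProjective_holds (A := A)) 1).hodgeLieC := by
  classical
  haveI : Module.Finite ℚ (bettiCohomology A.X 1) := finite_bettiCohomology_one A
  have heff := BettiUniverse.hodge_isEffective hHD (AbelianVariety.isSmoothProjective_holds (A := A)) 1
  set φQ : Module.End ℚ (bettiCohomology A.X 1) := (bettiCohomology.map φ.hom.hom.hom 1).hom with hφQ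
  have hφE : φQ ∈ (BettiUniverse.hodge hHD (AbelianVariety.isSmoothProjective_holds (A := A)) 1).endAlg := by
    have h := unop_bettiRep_mem_endAlg hHD hI (AbelianVariety.endAlgebra.of A φ)
    rwa [bettiRep_of, MulOpposite.unop_op] at h
  have hφ2 : φQ * φQ = -((d : ℚ) • 1) := bettiMapHom_mul_self hφ
  have hdQ : (0 : ℚ) < d := Nat.cast_pos.2 hd
  -- `dim A = 6`
  have hsum := eigenMultiplicity_add_eigenMultiplicity_neg_eq_dim A φ hd hφ
  have hA : 0 < A.dim := by rcases h42 with ⟨h4, h2⟩ | ⟨h2, h4⟩ <;> omega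
  have hE := exists_eq_smul_one_add_smul_bettiMapHom hHD hI hd hφ hE2 hA
  -- the eigenvalue `μ = i√d`
  have hμ₀ : (Complex.I * (Real.sqrt d : ℂ)) ^ 2 = -((d : ℚ) : ℂ) := by
    rw [mul_pow, Complex.I_sq, ← Complex.ofReal_pow, Real.sq_sqrt (Nat.cast_nonneg d), Complex.ofReal_natCast,
      Rat.cast_natCast, neg_one_mul]
  have hconj₀ : starRingEnd ℂ (Complex.I * (Real.sqrt d : ℂ)) = -(Complex.I * (Real.sqrt d : ℂ)) := by simp
  have h10 : Module.finrank ℂ ↥(Module.End.eigenspace (φQ.baseChange ℂ) (Complex.I * (Real.sqrt d : ℂ)) ⊓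
      (BettiUniverse.hodge hHD (AbelianVariety.isSmoothProjective_holds (A := A)) 1).piece 1 0) =
      eigenMultiplicity A φ (Complex.I * (Real.sqrt d : ℂ)) := by
    rw [hφQ, finrank_eigenspace_inf_piece_oneZero_eq_eigenMultiplicity hHD hI φ]
  have h01 : Module.finrank ℂ ↥(Module.End.eigenspace (φQ.baseChange ℂ) (Complex.I * (Real.sqrt d : ℂ)) ⊓
      (BettiUniverse.hodge hHD (AbelianVariety.isSmoothProjective_holds (A := A)) 1).piece 0 1) =
      eigenMultiplicity A φ (-(Complex.I * (Real.sqrt d : ℂ))) := by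
    rw [hφQ, finrank_eigenspace_inf_piece_zeroOne_eq_eigenMultiplicity_conj hHD hI φ, hconj₀]
  have h24 : (Module.finrank ℂ ↥(Module.End.eigenspace (φQ.baseChange ℂ) (Complex.I * (Real.sqrt d : ℂ)) ⊓
        (BettiUniverse.hodge hHD (AbelianVariety.isSmoothProjective_holds (A := A)) 1).piece 1 0) = 2 ∧
      Module.finrank ℂ ↥(Module.End.eigenspace (φQ.baseChange ℂ) (Complex.I * (Real.sqrt d : ℂ)) ⊓
        (BettiUniverse.hodge hHD (AbelianVariety.isSmoothProjective_holds (A := A)) 1).piece 0 1) = 4) ∨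
      (Module.finrank ℂ ↥(Module.End.eigenspace (φQ.baseChange ℂ) (Complex.I * (Real.sqrt d : ℂ)) ⊓
        (BettiUniverse.hodge hHD (AbelianVariety.isSmoothProjective_holds (A := A)) 1).piece 1 0) = 4 ∧
      Module.finrank ℂ ↥(Module.End.eigenspace (φQ.baseChange ℂ) (Complex.I * (Real.sqrt d : ℂ)) ⊓
        (BettiUniverse.hodge hHD (AbelianVariety.isSmoothProjective_holds (A := A)) 1).piece 0 1) = 2) := by
    rw [h10, h01]
    rcases h42 with ⟨h4, h2⟩ | ⟨h2, h4⟩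
    · exact Or.inr ⟨h4, h2⟩
    · exact Or.inl ⟨h2, h4⟩
  exact UnitaryThetaFourTwo.mem_hodgeLieC_of_commute_of_skew
    (BettiUniverse.hodge hHD (AbelianVariety.isSmoothProjective_holds (A := A)) 1) Nat.cast_one heff ψ hφE hdQ hφ2 hE
    hμ₀ h24

/-! ## §2 `B = D` on every abelian variety with slots over a `(4,2)` sixfold; the Hodge conjecture for all its powers -/

section Geometric

variable {B : AbelianVariety ℂ} {n : ℕ} {g : Fin n → (B ⟶ A)}

/-- **`B•(B) = D•(B) ⊗ ℂ` for every abelian variety `B` with slots over an abelian SIXFOLD `A` of Ribet type `(4,2)` —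
UNCONDITIONAL** (`φ ≫ φ = -d`, `d > 0`, `finrank_ℚ End⁰(A) = 2`, eigen-multiplicities `{4,2}`): G1's
`AVSlots.isDivisorGenerated_of_hodgeLieC_unitary` with `hU` discharged by §1, the polarization of `H¹(A(ℂ); ℚ)` and the
Betti-universe facts supplied as in R9. (MZ99 Table 1, row IV `(4,2)`, and (1.8): «`Hg(X) = U_k` ⟹ `D(Xⁿ) = B(Xⁿ)` for all
`n`».) [cite: MoonenZarhin1999LowDim, §1 (1.8), §2 (2.3) and Table 1] [cite: Ribet1983, Thm. 0] -/
theorem AVSlots.isDivisorGenerated_of_fourTwo (hg : AVSlots A B g) (φ : A ⟶ A) {d : ℕ} (hd : 0 < d)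
    (hφ : φ ≫ φ = -(d • 𝟙 A)) (hE2 : Module.finrank ℚ A.endAlgebra = 2)
    (h42 : (eigenMultiplicity A φ (Complex.I * (Real.sqrt d : ℂ)) = 4 ∧
        eigenMultiplicity A φ (-(Complex.I * (Real.sqrt d : ℂ))) = 2) ∨
      (eigenMultiplicity A φ (Complex.I * (Real.sqrt d : ℂ)) = 2 ∧
        eigenMultiplicity A φ (-(Complex.I * (Real.sqrt d : ℂ))) = 4)) :
    IsDivisorGenerated B := by
  classical
  have hHD : exists_isReal_hodgeModel := exists_isReal_hodgeModel_holds
  have hI : hodgePQ_independent_of_hodgeModel := hodgePQ_independent_of_hodgeModel_holds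
  haveI : HodgeTensorFacts.{0, 0} := hodgeTensorFacts_holds.{0, 0}
  have hX : IsSmoothProjective A.dim A.X := AbelianVariety.isSmoothProjective_holds
  -- a polarization of `H¹(A(ℂ); ℚ)`
  obtain ⟨ψ⟩ : (BettiUniverse.hodge hHD (AbelianVariety.isSmoothProjective_holds (A := A)) 1).IsPolarizable :=
    smoothProjective_hodgeStructure_isPolarizable_holds hX (BettiUniverse.realHodgeModel hHD hX)
      (BettiUniverse.realHodgeModel_isHodgeSymmetric hHD hX) 1
  have hsum := eigenMultiplicity_add_eigenMultiplicity_neg_eq_dim A φ hd hφ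
  have hA : 0 < A.dim := by rcases h42 with ⟨h4, h2⟩ | ⟨h2, h4⟩ <;> omega
  exact hg.isDivisorGenerated_of_hodgeLieC_unitary φ hd hφ hE2 hA hHD hI ψ
    (hodgeLieC_fourTwo_of_eigenMultiplicity φ hd hφ hE2 h42 hHD hI ψ)

/-- **All powers `A^{N+1}` of a `(4,2)` sixfold: `B•(A^{N+1}) = D•(A^{N+1}) ⊗ ℂ` — UNCONDITIONAL** (MZ99 Table 1 row IV
`(4,2)` with (1.8), for ALL members with `End⁰ = k`). [cite: MoonenZarhin1999LowDim, §1 (1.8) and Table 1] [cite: Ribet1983, Thm. 0] -/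
theorem AbelianVariety.isDivisorGenerated_powSucc_of_fourTwo (A : AbelianVariety ℂ) (φ : A ⟶ A) {d : ℕ} (hd : 0 < d)
    (hφ : φ ≫ φ = -(d • 𝟙 A)) (hE2 : Module.finrank ℚ A.endAlgebra = 2)
    (h42 : (eigenMultiplicity A φ (Complex.I * (Real.sqrt d : ℂ)) = 4 ∧
        eigenMultiplicity A φ (-(Complex.I * (Real.sqrt d : ℂ))) = 2) ∨
      (eigenMultiplicity A φ (Complex.I * (Real.sqrt d : ℂ)) = 2 ∧
        eigenMultiplicity A φ (-(Complex.I * (Real.sqrt d : ℂ))) = 4)) (N : ℕ) :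
    IsDivisorGenerated (A.powSucc N) :=
  (AVSlots.powSucc A N).isDivisorGenerated_of_fourTwo φ hd hφ hE2 h42

/-- `A` itself: `B•(A) = D•(A) ⊗ ℂ` for a `(4,2)` sixfold. [cite: MoonenZarhin1999LowDim, §1 (1.8) and Table 1] -/
theorem AbelianVariety.isDivisorGenerated_of_fourTwo (A : AbelianVariety ℂ) (φ : A ⟶ A) {d : ℕ} (hd : 0 < d)
    (hφ : φ ≫ φ = -(d • 𝟙 A)) (hE2 : Module.finrank ℚ A.endAlgebra = 2)
    (h42 : (eigenMultiplicity A φ (Complex.I * (Real.sqrt d : ℂ)) = 4 ∧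
        eigenMultiplicity A φ (-(Complex.I * (Real.sqrt d : ℂ))) = 2) ∨
      (eigenMultiplicity A φ (Complex.I * (Real.sqrt d : ℂ)) = 2 ∧
        eigenMultiplicity A φ (-(Complex.I * (Real.sqrt d : ℂ))) = 4)) :
    IsDivisorGenerated A :=
  (avSlots_self A).isDivisorGenerated_of_fourTwo φ hd hφ hE2 h42

/-- **The Hodge conjecture for all powers `A^{N+1}` of an abelian sixfold of Ribet type `(4,2)` — UNCONDITIONAL** (`B = D`
above with Lefschetz `(1,1)`: `hodgeConjectureFor_of_isDivisorGenerated`; MZ99 (1.7)). [cite: MoonenZarhin1999LowDim, §1 (1.7)–(1.8) and Table 1]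
[cite: vanGeemen1994HodgeAV, §2.4] -/
theorem hodgeConjectureFor_powSucc_of_fourTwo (A : AbelianVariety ℂ) (φ : A ⟶ A) {d : ℕ} (hd : 0 < d)
    (hφ : φ ≫ φ = -(d • 𝟙 A)) (hE2 : Module.finrank ℚ A.endAlgebra = 2)
    (h42 : (eigenMultiplicity A φ (Complex.I * (Real.sqrt d : ℂ)) = 4 ∧
        eigenMultiplicity A φ (-(Complex.I * (Real.sqrt d : ℂ))) = 2) ∨
      (eigenMultiplicity A φ (Complex.I * (Real.sqrt d : ℂ)) = 2 ∧
        eigenMultiplicity A φ (-(Complex.I * (Real.sqrt d : ℂ))) = 4)) (N : ℕ) :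
    HodgeConjectureFor (A.powSucc N).dim (A.powSucc N).X :=
  hodgeConjectureFor_of_isDivisorGenerated _ (AbelianVariety.isDivisorGenerated_powSucc_of_fourTwo A φ hd hφ hE2 h42 N)

/-- **The Hodge conjecture for every complex abelian variety isogenous to a power of a `(4,2)` sixfold — UNCONDITIONAL**
(van Geemen Lemma 3.7 = `HodgeConjectureFor.of_isIsogenous`). [cite: vanGeemen1994HodgeAV, Lemma 3.7]
[cite: MoonenZarhin1999LowDim, §1 (1.8) and Table 1] -/
theorem hodgeConjectureFor_of_isIsogenous_powSucc_of_fourTwo {A B' : AbelianVariety ℂ} (φ : A ⟶ A) {d : ℕ}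
    (hd : 0 < d) (hφ : φ ≫ φ = -(d • 𝟙 A)) (hE2 : Module.finrank ℚ A.endAlgebra = 2)
    (h42 : (eigenMultiplicity A φ (Complex.I * (Real.sqrt d : ℂ)) = 4 ∧
        eigenMultiplicity A φ (-(Complex.I * (Real.sqrt d : ℂ))) = 2) ∨
      (eigenMultiplicity A φ (Complex.I * (Real.sqrt d : ℂ)) = 2 ∧
        eigenMultiplicity A φ (-(Complex.I * (Real.sqrt d : ℂ))) = 4))
    {N : ℕ} (hB : B'.IsIsogenous (A.powSucc N)) : HodgeConjectureFor B'.dim B'.X :=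
  HodgeConjectureFor.of_isIsogenous hB (hodgeConjectureFor_powSucc_of_fourTwo A φ hd hφ hE2 h42 N)

end Geometric

end Literature.AlgebraicGeometry.HodgeTheory

end
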